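import Mathlib.AlgebraicGeometry.EllipticCurve.VariableChange
import Mathlib.NumberTheory.Padics.Hensel
import Mathlib.NumberTheory.Padics.RingHoms
import Summits.ABC.IUTFork.Repair.RcatZhou2TorsionSemistableWitness
import HarnessLib

/-!
# D-0123(C) IUT REPAIR-CATALOGUE (rung LADDER-ABC:A2), row RC-441 (Zhou 2025 «2-torsion initial Θ-data»,
# [IUTchI] Def. 3.1 (b) datum-class variant) — located check-list item 2: under the variant's clauses the
# curve `E_F` need NOT be `F`-isomorphic to a LEGENDRE curve `y² = x(x − 1)(x − λ)`, `λ ∈ F`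

Record file (D-0012) of the abc-iut cell, seat abc-iut-rcat-tst-7 (KEY RC441), gen 3; PROOF-ONLY (no definition,
no instance, no notation, no named fact). TAKES NO SIDE on [IUTchIII] Cor. 3.12 / [IUTchIV] Thm. 1.10, on any author
or on the variant (D-0045); nothing here asserts abc proved or refuted. The variant is a claim-tagged READING of
the literature; this file is classical algebra of ONE explicit curve.

CONTEXT (catalogue sheet HOME/staging/RCAT/tst-7/RC-441.md, K line (B)(ii) / C line). [IUTchIV] Thm. 1.10 (p. 22)
passes from `E_F` to the Legendre model over the «tripodal» field: «`F_tpd := F_mod(E_{F_mod}[2])` … a model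
`E_{F_tpd}` of `E_F ×_F F̄` over `F_tpd` determined by the Legendre form of the Weierstrass equation … [Thus, it
follows from Proposition 1.8, (iv), that `E_F ≅ E_{F_tpd} ×_{F_tpd} F` over `F`]», and the tree types this step
from the RATIONAL `3`-TORSION: abc-iut-L5-t12
`Literature.IUT.HodgeTheaters.InitialThetaData.exists_variableChange_eq_legendre` («`C • E_F = ⟨0, −(1 + λ), 0, λ, 0⟩`
for a change of variables `C` over `F`», Prop. 1.8 (iv) with `l = 3`). Zhou's variant (arXiv:2510.05448 §2.1,
render p0007 l.28–29) drops the `3`-torsion and says: «The condition “F(E[3]) = F” is also used to show that `E_F`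
has a model over `F_mod` in [IUTchIV], Theorem 1.10 and Corollary 2.2 … This is one of the conditions in the
definition of 2-torsion initial Θ-data» — i.e. the MODEL OVER `F_mod` is ASSUMED; the LEGENDRE shape over `F` is
not addressed at that locus. THIS FILE records, for the same semistable curve `E₂ : y² = x(x − 3)(x + 160)` as
`RcatZhou2TorsionSemistableWitness` (p526944: semistable over `ℚ`, full rational `2`-torsion, its own model over
`F_mod = ℚ`), that the literal conclusion «`E_F ≅` (Legendre curve) over `F`» can FAIL under the variant's clauses:

* `isSquare_of_smul_eq_legendre` — over ANY field `F` with `2 ≠ 0`: if some change of variables `C` over `F`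
  carries `E₂` to a Legendre equation `y² = x(x − 1)(x − λ)`, then one of `±3, ±160, ±163` (the differences of the
  `2`-torsion abscissae `0, 3, −160`) is a square in `F` (the change of variables has `s = t = 0`, `r` a
  `2`-torsion abscissa, and `u² =` a difference of two abscissae);
* `not_isSquare_padic17` — in `ℚ₁₇` none of `±3, ±160, ±163` is a square (they are `17`-adic units reducing to
  the non-residues `3, 14, 7, 10, 10, 7 (mod 17)`; `PadicInt.toZMod` + `decide`);
* `neg_one_isSquare_padic17` — `√−1 ∈ ℚ₁₇` (Hensel at `4`, `4² + 1 = 17`), so `ℚ(√−1) ⊂ ℚ₁₇` (`17` splits) and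
  `ℚ₁₇` itself is a field of characteristic `0` containing `√−1` in which `E₂` has rational `2`-torsion;
* `not_smul_eq_legendre` — hence for EVERY field `F` admitting a ring homomorphism `F →+* ℚ₁₇` (e.g.
  `F = ℚ`, `F = ℚ(√−1)`, `F = ℚ₁₇`), NO change of variables over `F` carries `E₂` to a Legendre equation.
So «`√−1 ∈ F` + `2`-torsion rational + semistable + model over `F_mod`» does NOT give print's Legendre isomorphism
over `F`; what it gives is a quadratic twist (by a difference of abscissae) — classical. Whether the variant's use
of [IUTchIV] §1–§2 needs the Legendre SHAPE over `F` (rather than a model over `F_mod`, which it assumes, or a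
Legendre curve by construction as on the `λ`-line of Cor. 2.2) is for the variant's author, not this cell
(located/proved classical facts ≠ adjudication). Standard axioms only; `ℚ₁₇` statements carry the instance
hypothesis `[Fact (Nat.Prime 17)]` (no instance is declared here).
-/

open WeierstrassCurve Polynomial

namespace Summit.ABC.IUTFork.Repair.RcatZhou2TorsionLegendreWitness

/-! ## 1. The algebraic criterion: a Legendre model forces a square difference of `2`-torsion abscissae -/

/-- **Criterion.** Over any field `F` with `2 ≠ 0`: if a change of variables `C = (u, r, s, t)` over `F` carries
`E₂ : y² = x³ + 157x² − 480x = x(x − 3)(x + 160)` to a Legendre equation `y² = x(x − 1)(x − λ) = x³ − (1 + λ)x² + λx`,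
then `s = t = 0`, `r ∈ {0, 3, −160}` and `u²` is the difference of two `2`-torsion abscissae, so one of
`3, −160, −3, −163, 160, 163` is a square in `F`. (Silverman AEC III.1: isomorphisms of Weierstrass equations;
the Legendre normal form III.1.7 needs a square root.) [cite: SilvermanAEC2009, III.1 Prop. 1.7] -/
theorem isSquare_of_smul_eq_legendre {F : Type*} [Field F] (h2 : (2 : F) ≠ 0) (C : VariableChange F) (la : F)
    (h : C • (⟨0, 157, 0, -480, 0⟩ : WeierstrassCurve F) = ⟨0, -(1 + la), 0, la, 0⟩) :
    IsSquare (3 : F) ∨ IsSquare (-160 : F) ∨ IsSquare (-3 : F) ∨ IsSquare (-163 : F) ∨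
      IsSquare (160 : F) ∨ IsSquare (163 : F) := by
  obtain ⟨u, r, s, t⟩ := C
  rw [WeierstrassCurve.ext_iff] at h
  simp only [variableChange_a₁, variableChange_a₂, variableChange_a₃, variableChange_a₄,
    variableChange_a₆] at h
  obtain ⟨h1, h2', h3, h4, h6⟩ := h
  have hw : ((u⁻¹ : Fˣ) : F) ≠ 0 := (u⁻¹).ne_zero
  have hvw : (u : F) * ((u⁻¹ : Fˣ) : F) = 1 := u.mul_inv
  -- `a₁`: `u⁻¹ (0 + 2s) = 0` forces `s = 0`; `a₃`: `u⁻³ (2t) = 0` forces `t = 0`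
  have hs : s = 0 := by
    rcases mul_eq_zero.mp h1 with h | h
    · exact absurd h hw
    · rcases mul_eq_zero.mp (show (2 : F) * s = 0 by linear_combination h) with h' | h'
      · exact absurd h' h2
      · exact h'
  have ht : t = 0 := by
    rcases mul_eq_zero.mp h3 with h | h
    · exact absurd h (pow_ne_zero 3 hw)
    · rcases mul_eq_zero.mp (show (2 : F) * t = 0 by linear_combination h) with h' | h'
      · exact absurd h' h2
      · exact h'
  subst hs ht
  -- `a₆`: `r` is a root of the `2`-division cubic `x(x − 3)(x + 160)`
  have hr : r * (r - 3) * (r + 160) = 0 := by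
    rcases mul_eq_zero.mp h6 with h | h
    · exact absurd h (pow_ne_zero 6 hw)
    · linear_combination h
  -- `a₂`, `a₄`: eliminating `λ` and clearing `u⁻¹` gives a quadratic equation for `u²`
  set w : F := ((u⁻¹ : Fˣ) : F) with hwdef
  set v : F := (u : F) with hvdef
  have e1 : w ^ 2 * (157 + 3 * r) + w ^ 4 * (3 * r ^ 2 + 314 * r - 480) + 1 = 0 := by
    linear_combination h2' + h4
  have key : v ^ 4 + (157 + 3 * r) * v ^ 2 + (3 * r ^ 2 + 314 * r - 480) = 0 := by
    linear_combination v ^ 4 * e1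
      - ((157 + 3 * r) * v ^ 2 * (1 + v * w) + (3 * r ^ 2 + 314 * r - 480) * (1 + v * w) * (1 + v ^ 2 * w ^ 2))
        * hvw
  -- the three cases for `r`
  rcases mul_eq_zero.mp hr with hr' | hr'
  · rcases mul_eq_zero.mp hr' with hr0 | hr3
    · -- `r = 0`: `(v² − 3)(v² + 160) = 0`
      subst hr0
      have hf : (v ^ 2 - 3) * (v ^ 2 + 160) = 0 := by linear_combination key
      rcases mul_eq_zero.mp hf with hq | hq
      · exact Or.inl ⟨v, by linear_combination -hq⟩
      · exact Or.inr (Or.inl ⟨v, by linear_combination -hq⟩)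
    · -- `r = 3`: `(v² + 3)(v² + 163) = 0`
      have hr3' : r = 3 := by linear_combination hr3
      subst hr3'
      have hf : (v ^ 2 + 3) * (v ^ 2 + 163) = 0 := by linear_combination key
      rcases mul_eq_zero.mp hf with hq | hq
      · exact Or.inr (Or.inr (Or.inl ⟨v, by linear_combination -hq⟩))
      · exact Or.inr (Or.inr (Or.inr (Or.inl ⟨v, by linear_combination -hq⟩)))
  · -- `r = −160`: `(v² − 160)(v² − 163) = 0`
    have hr' : r = -160 := by linear_combination hr'
    subst hr'
    have hf : (v ^ 2 - 160) * (v ^ 2 - 163) = 0 := by linear_combination key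
    rcases mul_eq_zero.mp hf with hq | hq
    · exact Or.inr (Or.inr (Or.inr (Or.inr (Or.inl ⟨v, by linear_combination -hq⟩))))
    · exact Or.inr (Or.inr (Or.inr (Or.inr (Or.inr ⟨v, by linear_combination -hq⟩))))

/-! ## 2. `17`-adic non-squares: `±3, ±160, ±163` are not squares in `ℚ₁₇` -/

/-- `3, 14, 7, 10, 10, 7` — the residues of `3, −3, 160, −160, 163, −163` mod `17` — are quadratic non-residues
(`(ℤ/17)ײ = {±1, ±2, ±4, ±8}`). Stated before any `Fact (Nat.Prime 17)` instance is in scope, so that `decide`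
evaluates in the ring `ZMod 17`. [folklore] -/
private theorem nonresidues_mod_17 :
    (∀ t : ZMod 17, t ^ 2 ≠ ((3 : ℤ) : ZMod 17)) ∧ (∀ t : ZMod 17, t ^ 2 ≠ ((-3 : ℤ) : ZMod 17)) ∧
      (∀ t : ZMod 17, t ^ 2 ≠ ((160 : ℤ) : ZMod 17)) ∧ (∀ t : ZMod 17, t ^ 2 ≠ ((-160 : ℤ) : ZMod 17)) ∧
      (∀ t : ZMod 17, t ^ 2 ≠ ((163 : ℤ) : ZMod 17)) ∧ (∀ t : ZMod 17, t ^ 2 ≠ ((-163 : ℤ) : ZMod 17)) := by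
  refine ⟨?_, ?_, ?_, ?_, ?_, ?_⟩ <;> decide

section Seventeen

variable [Fact (Nat.Prime 17)]

/-- A `17`-adic square root of an integer prime to `17` is a `17`-adic unit. [folklore] -/
private theorem norm_eq_one_of_sq_eq {z : ℚ_[17]} {d : ℤ} (hd : ¬ (17 : ℤ) ∣ d)
    (hz : z ^ 2 = (d : ℚ_[17])) : ‖z‖ = 1 := by
  have h1 : ‖(d : ℚ_[17])‖ = 1 := by
    refine le_antisymm (Padic.norm_int_le_one d) (not_lt.mp fun hlt => hd ?_)
    exact (Padic.norm_intCast_lt_one_iff (p := 17)).mp hlt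
  have h2 : ‖z‖ ^ 2 = 1 := by rw [← norm_pow, hz, h1]
  exact (pow_eq_one_iff_of_nonneg (norm_nonneg _) two_ne_zero).mp h2

/-- **Reduction mod `17`.** If the integer `d` is prime to `17` and `t² ≠ d` for every `t ∈ 𝔽₁₇`, then `d` is not
a square in `ℚ₁₇` (a square root would be a `17`-adic integer, and `PadicInt.toZMod` would give a square root
mod `17`). [folklore] -/
theorem not_isSquare_padic17 (d : ℤ) (hd : ¬ (17 : ℤ) ∣ d)
    (hres : ∀ t : ZMod 17, t ^ 2 ≠ (d : ZMod 17)) : ¬ IsSquare ((d : ℤ) : ℚ_[17]) := by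
  rintro ⟨z, hz⟩
  have hz2 : z ^ 2 = (d : ℚ_[17]) := by rw [sq]; exact hz.symm
  have hn := norm_eq_one_of_sq_eq hd hz2
  set zi : ℤ_[17] := ⟨z, hn.le⟩ with hzi_def
  have hzi : zi ^ 2 = (d : ℤ_[17]) := PadicInt.ext (by
    rw [PadicInt.coe_pow, PadicInt.coe_intCast]; exact hz2)
  have h := congrArg PadicInt.toZMod hzi
  rw [map_pow, map_intCast] at h
  exact hres _ h

/-- `3` is not a square in `ℚ₁₇` (`3` is a non-residue mod `17`). [folklore] -/
theorem not_isSquare_three : ¬ IsSquare (3 : ℚ_[17]) := by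
  have hd : ¬ (17 : ℤ) ∣ 3 := by decide
  have hres := nonresidues_mod_17.1
  simpa using not_isSquare_padic17 3 hd hres

/-- `−3` is not a square in `ℚ₁₇` (`−3 ≡ 14` is a non-residue mod `17`). [folklore] -/
theorem not_isSquare_neg_three : ¬ IsSquare (-3 : ℚ_[17]) := by
  have hd : ¬ (17 : ℤ) ∣ (-3) := by decide
  have hres := nonresidues_mod_17.2.1
  simpa using not_isSquare_padic17 (-3) hd hres

/-- `160` is not a square in `ℚ₁₇` (`160 ≡ 7` is a non-residue mod `17`). [folklore] -/
theorem not_isSquare_160 : ¬ IsSquare (160 : ℚ_[17]) := by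
  have hd : ¬ (17 : ℤ) ∣ 160 := by decide
  have hres := nonresidues_mod_17.2.2.1
  simpa using not_isSquare_padic17 160 hd hres

/-- `−160` is not a square in `ℚ₁₇` (`−160 ≡ 10` is a non-residue mod `17`). [folklore] -/
theorem not_isSquare_neg_160 : ¬ IsSquare (-160 : ℚ_[17]) := by
  have hd : ¬ (17 : ℤ) ∣ (-160) := by decide
  have hres := nonresidues_mod_17.2.2.2.1
  simpa using not_isSquare_padic17 (-160) hd hres

/-- `163` is not a square in `ℚ₁₇` (`163 ≡ 10` is a non-residue mod `17`). [folklore] -/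
theorem not_isSquare_163 : ¬ IsSquare (163 : ℚ_[17]) := by
  have hd : ¬ (17 : ℤ) ∣ 163 := by decide
  have hres := nonresidues_mod_17.2.2.2.2.1
  simpa using not_isSquare_padic17 163 hd hres

/-- `−163` is not a square in `ℚ₁₇` (`−163 ≡ 7` is a non-residue mod `17`). [folklore] -/
theorem not_isSquare_neg_163 : ¬ IsSquare (-163 : ℚ_[17]) := by
  have hd : ¬ (17 : ℤ) ∣ (-163) := by decide
  have hres := nonresidues_mod_17.2.2.2.2.2
  simpa using not_isSquare_padic17 (-163) hd hres

/-- **`√−1 ∈ ℚ₁₇`** (Hensel's lemma at `a = 4`: `4² + 1 = 17`, `‖17‖ = 17⁻¹ < ‖2·4‖² = 1`). Hence `17` splits in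
`ℚ(√−1)` and `ℚ(√−1) ⊂ ℚ₁₇`; and `ℚ₁₇` is itself a field of characteristic `0` containing `√−1`.
[cite: SilvermanAEC2009, VII.1 (Hensel's lemma)] -/
theorem neg_one_isSquare_padic17 : IsSquare (-1 : ℚ_[17]) := by
  have hnorm : ‖Polynomial.aeval (4 : ℤ_[17]) (X ^ 2 + 1 : ℤ[X])‖ <
      ‖Polynomial.aeval (4 : ℤ_[17]) (Polynomial.derivative (X ^ 2 + 1 : ℤ[X]))‖ ^ 2 := by
    have e1 : Polynomial.aeval (4 : ℤ_[17]) (X ^ 2 + 1 : ℤ[X]) = ((17 : ℕ) : ℤ_[17]) := by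
      simp only [map_add, map_pow, aeval_X, map_one]; norm_num
    have e2 : Polynomial.aeval (4 : ℤ_[17]) (Polynomial.derivative (X ^ 2 + 1 : ℤ[X])) = ((8 : ℤ) : ℤ_[17]) := by
      simp only [derivative_add, derivative_X_pow, derivative_one, add_zero, map_mul, map_natCast, map_pow,
        aeval_X]
      norm_num
    have h8 : ‖((8 : ℤ) : ℤ_[17])‖ = 1 := by
      refine le_antisymm (PadicInt.norm_le_one _) (not_lt.mp fun hlt => ?_)
      exact absurd ((PadicInt.norm_int_lt_one_iff_dvd 8).mp hlt) (by decide)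
    rw [e1, e2, PadicInt.norm_p, h8]
    norm_num
  obtain ⟨z, hz, -⟩ := hensels_lemma hnorm
  have hz' : (z : ℚ_[17]) ^ 2 + 1 = 0 := by
    have h := congrArg ((↑) : ℤ_[17] → ℚ_[17]) hz
    simpa using h
  exact ⟨z, by linear_combination -hz'⟩

/-! ## 3. No Legendre model for `E₂` over any field embedding in `ℚ₁₇` -/

/-- **No Legendre model.** For every field `F` admitting a ring homomorphism `φ : F →+* ℚ₁₇` — e.g. `F = ℚ`,
`F = ℚ(√−1)` (`17` splits: `4² ≡ −1`), `F = ℚ₁₇` — NO change of variables over `F` carries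
`E₂ : y² = x(x − 3)(x + 160)` to a Legendre equation `y² = x(x − 1)(x − λ)` with `λ ∈ F`: a square among
`±3, ±160, ±163` in `F` would map to a square in `ℚ₁₇`. With `RcatZhou2TorsionSemistableWitness` (p526944):
`E₂` is semistable over `ℚ`, has full rational `2`-torsion and is its own model over `F_mod = ℚ`, and `√−1 ∈ ℚ₁₇`
(`neg_one_isSquare_padic17`) — so under «`√−1 ∈ F` + `2`-torsion rational + semistable + model over `F_mod`» the
curve need not be `F`-isomorphic to a Legendre curve (print's «`E_F ≅ E_{F_tpd} ×_{F_tpd} F`», [IUTchIV] Thm. 1.10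
p. 22, there via Prop. 1.8 (iv) from the rational `3`-torsion). Classical; no claim about the variant's own route.
[cite: SilvermanAEC2009, III.1 Prop. 1.7] -/
theorem not_smul_eq_legendre {F : Type*} [Field F] (φ : F →+* ℚ_[17]) (C : VariableChange F) (la : F) :
    C • (⟨0, 157, 0, -480, 0⟩ : WeierstrassCurve F) ≠ ⟨0, -(1 + la), 0, la, 0⟩ := by
  intro h
  have h2 : (2 : F) ≠ 0 := by
    intro h0
    have : (2 : ℚ_[17]) = 0 := by rw [← map_ofNat φ 2, h0, map_zero]
    exact two_ne_zero this
  have hmap : ∀ x : F, IsSquare x → IsSquare (φ x) := fun x ⟨y, hy⟩ => ⟨φ y, by rw [hy, map_mul]⟩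
  rcases isSquare_of_smul_eq_legendre h2 C la h with hq | hq | hq | hq | hq | hq
  · have h' := hmap _ hq; rw [map_ofNat] at h'; exact not_isSquare_three h'
  · have h' := hmap _ hq; rw [map_neg, map_ofNat] at h'; exact not_isSquare_neg_160 h'
  · have h' := hmap _ hq; rw [map_neg, map_ofNat] at h'; exact not_isSquare_neg_three h'
  · have h' := hmap _ hq; rw [map_neg, map_ofNat] at h'; exact not_isSquare_neg_163 h'
  · have h' := hmap _ hq; rw [map_ofNat] at h'; exact not_isSquare_160 h'
  · have h' := hmap _ hq; rw [map_ofNat] at h'; exact not_isSquare_163 h'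

/-- **The witness field itself**: over `F = ℚ₁₇` (characteristic `0`, `√−1 ∈ F`, `E₂` with rational `2`-torsion
and integral coefficients) there is no Legendre model of `E₂`. [folklore] -/
theorem not_smul_eq_legendre_padic17 (C : VariableChange ℚ_[17]) (la : ℚ_[17]) :
    C • (⟨0, 157, 0, -480, 0⟩ : WeierstrassCurve ℚ_[17]) ≠ ⟨0, -(1 + la), 0, la, 0⟩ :=
  not_smul_eq_legendre (RingHom.id _) C la

/-- Over `F = ℚ` (the field of moduli of `E₂`, where `E₂` is its own model): no Legendre model either — as it must
be, since already `3 = e₂ − e₁` etc. are not rational squares; recorded via the embedding `ℚ →+* ℚ₁₇`. [folklore] -/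
theorem not_smul_eq_legendre_rat (C : VariableChange ℚ) (la : ℚ) :
    C • (⟨0, 157, 0, -480, 0⟩ : WeierstrassCurve ℚ) ≠ ⟨0, -(1 + la), 0, la, 0⟩ :=
  not_smul_eq_legendre (Rat.castHom ℚ_[17]) C la

end Seventeen

end Summit.ABC.IUTFork.Repair.RcatZhou2TorsionLegendreWitness
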